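import Mathlib
import Summits.Ventures.PercRepro2.Defs
import Summits.Ventures.PercRepro2.Independence
import Summits.Ventures.PercRepro2.Harris
import Summits.Ventures.PercRepro2.Graph
import Summits.Ventures.PercRepro2.Exploration
import Summits.Ventures.PercRepro2.Events
import Summits.Ventures.PercRepro2.FourFunctions
import Summits.Ventures.PercRepro2.Induced
import Summits.Ventures.PercRepro2.Frontier
import Summits.Ventures.PercRepro2.ObsIndependence
import Summits.Ventures.PercRepro2.BHK
import Summits.Ventures.PercRepro2.BHKEvents
import Summits.Ventures.PercRepro2.MultiSource
import Summits.Ventures.PercRepro2.OrderPreservation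
import Summits.Ventures.PercRepro2.SeedSet
import Summits.Ventures.PercRepro2.MultiSourceFun

/-!
# Cross-cluster negative correlation for a seed set; the three-root inequalities
(blind cell PercRepro2, typer-1)

For a seed set `T`, a vertex `t` and up-sets `𝓤`, `𝓥` of vertex sets:

  `P(C(T) ∈ 𝓤, C(t) ∈ 𝓥, t ∉ C(T)) · P(t ∉ C(T)) ≤ P(C(T) ∈ 𝓤, t ∉ C(T)) · P(C(t) ∈ 𝓥, t ∉ C(T))`

(`bhk_cross_clusterT`) — p1's `bhk_cross_cluster` with the root replaced by the seed set.  Proof: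
the tower identity `prob_clusterSetIn_inter_eq_expect` (explore `C(T)`; on `{t ∉ C(T)}` the cluster
of `t` lives in `G ∖ C(T)`, so `P(C(T) ∈ 𝓤, C(t) ∈ 𝓥, t ∉ C(T)) = E[1_𝓤(C(T)) · g(C(T)) · 1{t ∉ C(T)}]`
with the antitone `g(W) = P(C(t) ∈ 𝓥 in G ∖ W)` = p1's `delClusterProb`), then the functional
multi-source BHK (`bhk_multi`, `X = Y = {t}`) for `F₁ = 1_𝓤`, `F₂ = 1 − g`.

Corollaries (the lead's three-root inequalities, `proofs/LEAD-PROOFSHAPES.md` §8.9 ADDENDUM 9 (3)):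
**NC13′** `P(o ∈ C(a₁) ∪ C(a₃), b ↔ a₂, a₂ ∉ C(a₁) ∪ C(a₃)) · P(a₂ ∉ …) ≤ P(o ∈ …, a₂ ∉ …) · P(b ↔ a₂, a₂ ∉ …)`
(`nc_three_root`, `T = {a₁, a₃}`) and **NC12′** (`nc_three_root'`, `T = {a₁, a₂}`, root `a₃`).
-/

namespace Summit.Ventures.PercRepro2

section SeedEvents

variable {V : Type*} {E : Type*}

/-- `{C(T) ∈ 𝓤}`: the union cluster of the seed set `T` belongs to the family `𝓤`. -/
def clusterSetInEvent (ends : E → Sym2 V) (T : Finset V) (𝓤 : Set (Set V)) : Set (Config E) :=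
  {ω | clusterSet ends ω T ∈ 𝓤}

/-- Membership in `clusterSetInEvent`. -/
@[simp] lemma mem_clusterSetInEvent {ends : E → Sym2 V} {T : Finset V} {𝓤 : Set (Set V)}
    {ω : Config E} : ω ∈ clusterSetInEvent ends T 𝓤 ↔ clusterSet ends ω T ∈ 𝓤 := Iff.rfl

/-- For an up-set `𝓤`, `{C(T) ∈ 𝓤}` is increasing. -/
lemma isUpperSet_clusterSetInEvent (ends : E → Sym2 V) (T : Finset V) {𝓤 : Set (Set V)}
    (h𝓤 : IsUpperSet 𝓤) : IsUpperSet (clusterSetInEvent ends T 𝓤) :=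
  fun _ _ h hω => h𝓤 (clusterSet_mono h T) hω

/-- `{x ∈ C(T)}` is `{C(T) ∈ {W | x ∈ W}}`. -/
lemma memClusterSetEvent_eq_clusterSetInEvent (ends : E → Sym2 V) (T : Finset V) (x : V) :
    memClusterSetEvent ends T x = clusterSetInEvent ends T {W | x ∈ W} := rfl

/-- `{t ∉ C(T)}` is the avoidance event `avoidAllT ends T {t}`. -/
lemma mem_avoidAllT_singleton {ends : E → Sym2 V} {T : Finset V} {t : V} {ω : Config E} :
    ω ∈ avoidAllT ends T {t} ↔ t ∉ clusterSet ends ω T := by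
  simp [avoidAllT, mem_clusterSet]

/-- On `{t ∉ C(T)}`, the cluster of `t` is its cluster in `G ∖ C(T)`. -/
lemma cluster_delConfig_clusterSet {ends : E → Sym2 V} {ω : Config E} {T : Finset V} {t : V}
    (ht : t ∉ clusterSet ends ω T) :
    cluster ends (delConfig ends (clusterSet ends ω T) ω) t = cluster ends ω t := by
  classical
  rw [delConfig_eq_restrict]
  ext w
  simp only [mem_cluster]
  exact conn_restrict_iff_of_clusterSet_eq rfl ht

end SeedEvents

section CrossT

variable {V : Type*} {E : Type*} [Fintype E] [DecidableEq E] [Fintype V] [DecidableEq V]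
  {R : Type*} [CommRing R] [LinearOrder R] [IsStrictOrderedRing R]

omit [DecidableEq V] [LinearOrder R] [IsStrictOrderedRing R] in
/-- **Exploring the cluster of the seed set `T`**: for families `𝓤, 𝓥` of vertex sets,
`P(C(T) ∈ 𝓤, C(t) ∈ 𝓥, t ∉ C(T)) = E[1_𝓤(C(T)) · g(C(T)) · 1{t ∉ C(T)}]` with
`g = delClusterProb p ends t 𝓥`. -/
theorem prob_clusterSetIn_inter_eq_expect (p : E → R) (ends : E → Sym2 V) (T : Finset V) (t : V)
    (𝓤 𝓥 : Set (Set V)) :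
    prob p (clusterSetInEvent ends T 𝓤 ∩ clusterInEvent ends t 𝓥 ∩ avoidAllT ends T {t}) =
      expect p (fun ω => 𝓤.indicator 1 (clusterSet ends ω T) *
        delClusterProb p ends t 𝓥 (clusterSet ends ω T) * (avoidAllT ends T {t}).indicator 1 ω) := by
  classical
  let c : Set V → R := fun W => 𝓤.indicator 1 W * ({W' : Set V | t ∉ W'}.indicator 1 W)
  let D : Set V → Config E → R := fun W =>
    ({ω | cluster ends (delConfig ends W ω) t ∈ 𝓥} : Set (Config E)).indicator 1
  let Φ : Set V → Config E → R := fun W ω => c W * D W ω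
  have hΦ : ∀ W, DependsOn (Φ W) (touches ends W)ᶜ := by
    intro W ω ω' h
    simp only [Φ, D]
    congr 1
    refine dependsOn_indicator (R := R) (fun ω ω' h => ?_) h
    show (cluster ends (delConfig ends W ω) t ∈ 𝓥) = (cluster ends (delConfig ends W ω') t ∈ 𝓥)
    rw [delConfig_congr h]
  have hS : ∀ W : Set V, DependsOn (· ∈ {ω | clusterSet ends ω T = W}) (touches ends W) :=
    fun W => dependsOn_clusterSetEvent ends T W
  have hdisj : ∀ W : Set V, Disjoint (touches ends W) (touches ends W)ᶜ :=
    fun W => disjoint_compl_right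
  -- pointwise: the indicator of the event is `Φ (C(T) ω) ω`
  have hpt : ∀ ω, (clusterSetInEvent ends T 𝓤 ∩ clusterInEvent ends t 𝓥 ∩
      avoidAllT ends T {t}).indicator (1 : Config E → R) ω = Φ (clusterSet ends ω T) ω := by
    intro ω
    simp only [Φ, c, D]
    by_cases hst : t ∈ clusterSet ends ω T
    · have h1 : ω ∉ clusterSetInEvent ends T 𝓤 ∩ clusterInEvent ends t 𝓥 ∩ avoidAllT ends T {t} :=
        fun h => mem_avoidAllT_singleton.1 h.2 hst
      rw [Set.indicator_of_notMem h1,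
        Set.indicator_of_notMem
          (show clusterSet ends ω T ∉ {W' : Set V | t ∉ W'} from fun h => h hst)]
      simp
    · have e := cluster_delConfig_clusterSet (ends := ends) (ω := ω) (T := T) hst
      have hmem : ω ∈ {ω' | cluster ends (delConfig ends (clusterSet ends ω T) ω') t ∈ 𝓥} ↔
          cluster ends ω t ∈ 𝓥 := by
        rw [Set.mem_setOf_eq, e]
      have hav : ω ∈ avoidAllT ends T {t} := mem_avoidAllT_singleton.2 hst
      rw [Set.indicator_of_mem (show clusterSet ends ω T ∈ {W' : Set V | t ∉ W'} from hst)]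
      by_cases h𝓤 : clusterSet ends ω T ∈ 𝓤
      · rw [Set.indicator_of_mem h𝓤]
        by_cases h𝓥 : cluster ends ω t ∈ 𝓥
        · rw [Set.indicator_of_mem (show ω ∈ clusterSetInEvent ends T 𝓤 ∩ clusterInEvent ends t 𝓥 ∩
              avoidAllT ends T {t} from ⟨⟨h𝓤, h𝓥⟩, hav⟩), Set.indicator_of_mem (hmem.2 h𝓥)]
          simp
        · rw [Set.indicator_of_notMem (show ω ∉ clusterSetInEvent ends T 𝓤 ∩
              clusterInEvent ends t 𝓥 ∩ avoidAllT ends T {t} from fun h => h𝓥 h.1.2),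
            Set.indicator_of_notMem (fun h => h𝓥 (hmem.1 h))]
          simp
      · rw [Set.indicator_of_notMem (show ω ∉ clusterSetInEvent ends T 𝓤 ∩
            clusterInEvent ends t 𝓥 ∩ avoidAllT ends T {t} from fun h => h𝓤 h.1.1),
          Set.indicator_of_notMem h𝓤]
        simp
  -- `E[Φ W] = c W · g W`
  have hΦexp : ∀ W, expect p (Φ W) = c W * delClusterProb p ends t 𝓥 W := by
    intro W
    simp only [Φ, D]
    rw [expect_const_mul, ← prob_eq_expect_indicator]
    rfl
  rw [prob_eq_expect_indicator]
  have e1 : (clusterSetInEvent ends T 𝓤 ∩ clusterInEvent ends t 𝓥 ∩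
      avoidAllT ends T {t}).indicator (1 : Config E → R) = fun ω => Φ (clusterSet ends ω T) ω :=
    funext hpt
  rw [e1, expect_tower p hdisj (S := fun ω => clusterSet ends ω T) hS hΦ]
  simp only [hΦexp]
  unfold expect
  refine Finset.sum_congr rfl fun ω _ => ?_
  simp only [c]
  by_cases hst : t ∈ clusterSet ends ω T
  · rw [Set.indicator_of_notMem
        (show clusterSet ends ω T ∉ {W' : Set V | t ∉ W'} from fun h => h hst),
      Set.indicator_of_notMem (show ω ∉ avoidAllT ends T {t} from
        fun h => mem_avoidAllT_singleton.1 h hst)]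
    simp
  · rw [Set.indicator_of_mem (show clusterSet ends ω T ∈ {W' : Set V | t ∉ W'} from hst),
      Set.indicator_of_mem (show ω ∈ avoidAllT ends T {t} from mem_avoidAllT_singleton.2 hst)]
    simp

/-- **Functional multi-source BHK, same avoided vertex**: for nonnegative monotone functionals
`F₁, F₂` of the union cluster `C(T)` and the avoidance `R = {t ∉ C(T)}`,
`E(F₁(C(T)) 1_R) · E(F₂(C(T)) 1_R) ≤ E((F₁F₂)(C(T)) 1_R) · P(R)`. -/
theorem bhk_multi_same (p : E → R) (hp : IsProbVec p) (ends : E → Sym2 V) (T : Finset V) (t : V)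
    {F₁ F₂ : Set V → R} (hF₁ : Monotone F₁) (hF₂ : Monotone F₂) (hF₁0 : ∀ S, 0 ≤ F₁ S)
    (hF₂0 : ∀ S, 0 ≤ F₂ S) :
    expect p (fun ω => F₁ (clusterSet ends ω T) * (avoidAllT ends T {t}).indicator 1 ω) *
        expect p (fun ω => F₂ (clusterSet ends ω T) * (avoidAllT ends T {t}).indicator 1 ω) ≤
      expect p (fun ω => F₁ (clusterSet ends ω T) * F₂ (clusterSet ends ω T) *
          (avoidAllT ends T {t}).indicator 1 ω) *
        prob p (avoidAllT ends T {t}) := by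
  have h := bhk_multi p hp ends T hF₁ hF₂ hF₁0 hF₂0 {t} {t}
  simpa only [Finset.inter_self, Finset.union_self, Pi.mul_apply] using h

/-- **BHK, different clusters, for a seed set** (the lead's three-root mechanism): for up-sets
`𝓤, 𝓥` of vertex sets,
`P(C(T) ∈ 𝓤, C(t) ∈ 𝓥, t ∉ C(T)) · P(t ∉ C(T)) ≤ P(C(T) ∈ 𝓤, t ∉ C(T)) · P(C(t) ∈ 𝓥, t ∉ C(T))`. -/
theorem bhk_cross_clusterT (p : E → R) (hp : IsProbVec p) (ends : E → Sym2 V) (T : Finset V)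
    (t : V) {𝓤 𝓥 : Set (Set V)} (h𝓤 : IsUpperSet 𝓤) (h𝓥 : IsUpperSet 𝓥) :
    prob p (clusterSetInEvent ends T 𝓤 ∩ clusterInEvent ends t 𝓥 ∩ avoidAllT ends T {t}) *
        prob p (avoidAllT ends T {t}) ≤
      prob p (clusterSetInEvent ends T 𝓤 ∩ avoidAllT ends T {t}) *
        prob p (clusterInEvent ends t 𝓥 ∩ avoidAllT ends T {t}) := by
  classical
  set g := delClusterProb p ends t 𝓥 with hg
  have hg_anti : Antitone g := delClusterProb_anti p hp ends t h𝓥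
  have hg1 : ∀ W, g W ≤ 1 := delClusterProb_le_one p hp ends t 𝓥
  -- the two tower identities
  have eUV := prob_clusterSetIn_inter_eq_expect p ends T t 𝓤 𝓥
  have eV := prob_clusterSetIn_inter_eq_expect p ends T t Set.univ 𝓥
  simp only [Set.indicator_univ, Pi.one_apply, one_mul] at eV
  have eV' : clusterSetInEvent ends T Set.univ ∩ clusterInEvent ends t 𝓥 ∩ avoidAllT ends T {t} =
      clusterInEvent ends t 𝓥 ∩ avoidAllT ends T {t} := by
    ext ω; simp [clusterSetInEvent]
  rw [eV'] at eV
  -- BHK with `F₁ = 1_𝓤`, `F₂ = 1 − g`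
  have hF₁ : Monotone (𝓤.indicator (1 : Set V → R)) := by
    intro W W' h
    by_cases hW : W ∈ 𝓤
    · simp [Set.indicator_of_mem hW, Set.indicator_of_mem (h𝓤 h hW)]
    · rw [Set.indicator_of_notMem hW]
      exact Set.indicator_apply_nonneg fun _ => zero_le_one
  have hF₂ : Monotone (fun W => 1 - g W) := fun W W' h => by
    simp only
    linarith [hg_anti h]
  have hF₁0 : ∀ W, 0 ≤ 𝓤.indicator (1 : Set V → R) W :=
    fun W => Set.indicator_apply_nonneg fun _ => zero_le_one
  have hF₂0 : ∀ W, 0 ≤ 1 - g W := fun W => by linarith [hg1 W]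
  have key := bhk_multi_same p hp ends T t hF₁ hF₂ hF₁0 hF₂0
  -- rewrite the four expectations
  have eU : expect p (fun ω => 𝓤.indicator 1 (clusterSet ends ω T) *
      (avoidAllT ends T {t}).indicator 1 ω) =
      prob p (clusterSetInEvent ends T 𝓤 ∩ avoidAllT ends T {t}) := by
    rw [prob_eq_expect_indicator]
    unfold expect
    refine Finset.sum_congr rfl fun ω _ => ?_
    congr 1
    rw [indicator_inter_one]
    rfl
  have eR : prob p (avoidAllT ends T {t}) =
      expect p fun ω => (avoidAllT ends T {t}).indicator 1 ω :=
    prob_eq_expect_indicator p _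
  have e2 : expect p (fun ω => (1 - g (clusterSet ends ω T)) *
      (avoidAllT ends T {t}).indicator 1 ω) =
      prob p (avoidAllT ends T {t}) - prob p (clusterInEvent ends t 𝓥 ∩ avoidAllT ends T {t}) := by
    rw [eV, eR, ← expect_sub]
    congr 1
    funext ω
    simp only [Pi.sub_apply]
    ring
  have e3 : expect p (fun ω => 𝓤.indicator 1 (clusterSet ends ω T) * (1 - g (clusterSet ends ω T)) *
      (avoidAllT ends T {t}).indicator 1 ω) =
      prob p (clusterSetInEvent ends T 𝓤 ∩ avoidAllT ends T {t}) -
        prob p (clusterSetInEvent ends T 𝓤 ∩ clusterInEvent ends t 𝓥 ∩ avoidAllT ends T {t}) := by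
    rw [eUV, ← eU, ← expect_sub]
    congr 1
    funext ω
    simp only [Pi.sub_apply]
    ring
  rw [eU, e2, e3] at key
  nlinarith [key]

/-- **NC13′** (LEAD-PROOFSHAPES §8.9 ADDENDUM 9 (3)(b)): with `Ũ = C(a₁) ∪ C(a₃)`,
`P(o ∈ Ũ, b ↔ a₂, a₂ ∉ Ũ) · P(a₂ ∉ Ũ) ≤ P(o ∈ Ũ, a₂ ∉ Ũ) · P(b ↔ a₂, a₂ ∉ Ũ)`. -/
theorem nc_three_root (p : E → R) (hp : IsProbVec p) (ends : E → Sym2 V) (o a₁ a₂ a₃ b : V) :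
    prob p (memClusterSetEvent ends {a₁, a₃} o ∩ connEvent ends a₂ b ∩
          avoidAllT ends {a₁, a₃} {a₂}) *
        prob p (avoidAllT ends {a₁, a₃} {a₂}) ≤
      prob p (memClusterSetEvent ends {a₁, a₃} o ∩ avoidAllT ends {a₁, a₃} {a₂}) *
        prob p (connEvent ends a₂ b ∩ avoidAllT ends {a₁, a₃} {a₂}) := by
  rw [memClusterSetEvent_eq_clusterSetInEvent, connEvent_eq_clusterInEvent ends a₂ b]
  exact bhk_cross_clusterT p hp ends {a₁, a₃} a₂ (isUpperSet_mem_setOf o) (isUpperSet_mem_setOf b)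

/-- **NC12′** (ADDENDUM 9 (3)(c)): the same with the roles `(a₁, a₂ | a₃)`:
`P(o ∈ C(a₁) ∪ C(a₂), b ↔ a₃, a₃ ∉ …) · P(a₃ ∉ …) ≤ P(o ∈ …, a₃ ∉ …) · P(b ↔ a₃, a₃ ∉ …)`. -/
theorem nc_three_root' (p : E → R) (hp : IsProbVec p) (ends : E → Sym2 V) (o a₁ a₂ a₃ b : V) :
    prob p (memClusterSetEvent ends {a₁, a₂} o ∩ connEvent ends a₃ b ∩
          avoidAllT ends {a₁, a₂} {a₃}) *
        prob p (avoidAllT ends {a₁, a₂} {a₃}) ≤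
      prob p (memClusterSetEvent ends {a₁, a₂} o ∩ avoidAllT ends {a₁, a₂} {a₃}) *
        prob p (connEvent ends a₃ b ∩ avoidAllT ends {a₁, a₂} {a₃}) :=
  nc_three_root p hp ends o a₁ a₃ a₂ b

end CrossT

end Summit.Ventures.PercRepro2
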